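import Summits.ResolutionOfSingularities.ResolutionOfSingularities.Theorems.DeltaCutLaw2
import HarnessLib

/-!
# DeltaCutLaw2B — decomp-res node «DeltaCut» (lens-6 g23, critic row 181 CLEARED DECIDED +1 · MAP +1 (lane (b))),
tree file 5/8 of the node

Content VERBATIM from the decomp-res lens-6 g23 node `HOME/decomp-res-lens-6/g23/DeltaCut.lean` (pin a85f83d5) /
`DeltaCutJ.lean` (9b3a0295); imports the
landed tree only, carries nothing; HOME = run/shared/lean/pub/decomp-res; critic row 181 CLEARED DECIDED +1 · MAP +1
(lane (b)); landing orders NODE-g23.md §10 /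
INBOX :883 — provenance, critic text and the lens header in full in the first file of the node, `DeltaCutLaw`.
Namespace `…Theorems.DeltaCutClasses`;
`--supports stmt-ResolutionOfSingularities-26971`; cone-free.

## This file

Continuation 2/2 of `DeltaCutLaw2` (same sections of the node, cut at the 400-line cap): carries `nearPointFree_or`,
`nearPointFree_splitOrLightOrDeltaLight`, `wor_of_nearPointFree`, `wor_of_splitOrLightOrDeltaLight`.

[WRITER NOTE (decomp-res writer g11): file split only (tree files ≤ 400 lines); `noncomputable section`, universe,
namespace, sections, section
variables, the `open` lines and every declaration exactly as in the lens; no instance, no notation, no include/omit added.]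

(Sources: Hironaka1967 (characteristic polyhedra); CossartJannsenSaito2020 Def. 3.13 / Thm. 3.14 p. 129, Ch. 8 pp.
128–135, Thm. 9.6 p. 136; Hironaka1970 (near points / vertices); CossartPiltant2008 §2; Giraud1975; EGAIV4 §16–§17
(formal smoothness); StacksProject 0804 / 0BIQ / 031I; Matsumura1987 §28.)
-/

noncomputable section

open CategoryTheory CategoryTheory.Limits AlgebraicGeometry TopologicalSpace IsLocalRing
open Literature.AlgebraicGeometry.Resolution
universe u

open Summit.ResolutionOfSingularities.ResolutionOfSingularities.Theorems.TwistCutClasses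
open Summit.ResolutionOfSingularities.ResolutionOfSingularities.Theorems.LightCutClasses

namespace Summit.ResolutionOfSingularities.ResolutionOfSingularities.Theorems.DeltaCutClasses

section OffCentreN

open Summit.ResolutionOfSingularities.ResolutionOfSingularities.Theorems
open WeakOrderReduction ForcedTowerClasses SubfieldContactClasses AbsoluteContactClasses PurityValveClasses
variable {Y Y' : Scheme.{0}} {π : Y' ⟶ Y} {C : Y.IdealSheafData}

/-- Near-point-free predicates are closed under disjunction (so «split ∨ light ∨ δ-light» is one). [elementary] [folklore] -/
theorem nearPointFree_or {n : ℕ} {P Q : ∀ ⦃Y : Scheme.{0}⦄, Y.IdealSheafData → Y → Prop} (hP : NearPointFree n P)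
    (hQ : NearPointFree n Q) : NearPointFree n (fun _ I y => P I y ∨ Q I y) :=
  ⟨fun _ hY M hM _ hyc h => h.elim (hP.1 hY M hM hyc) (hQ.1 hY M hM hyc),
    fun _ _ _ _ hπ I b _ hy => or_congr (hP.2 hπ I b hy) (hQ.2 hπ I b hy)⟩

/-- «split ∨ light ∨ δ-light» is near-point-free. [new] [folklore] -/
theorem nearPointFree_splitOrLightOrDeltaLight {n : ℕ} (hn : 1 ≤ n) :
    NearPointFree n (fun _ I y => (DiffSplitAt I n y ∨ LightAt I n y) ∨ DeltaLightAt I n y) :=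
  nearPointFree_or (nearPointFree_splitOrLight hn) (nearPointFree_deltaLight hn)

end OffCentreN

section Closing

open Summit.ResolutionOfSingularities.ResolutionOfSingularities.Theorems
open WeakOrderReduction ForcedTowerClasses SubfieldContactClasses AbsoluteContactClasses PurityValveClasses

/-! ### §R-c engine: the DECIDED side closes for ANY near-point-free predicate (pattern of `worTopNonSplitLight_of_orderUSC`) -/

/-- **GENERIC CLOSING ENGINE.**  If every wild closed top point of an `n`-datum satisfies a near-point-free predicate `P`, the
datum has a weak resolution — given `WORAllAbs n` (the absolute-contact cell, DECIDED in the tree from `E 5`).  [new; the tree's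
`worTopNonSplitLight_of_orderUSC` with `P` abstracted] [folklore] -/
theorem wor_of_nearPointFree {P : ∀ ⦃Y : Scheme.{0}⦄, Y.IdealSheafData → Y → Prop} {n : ℕ} (hP : NearPointFree n P)
    (hU : OrderUSC) (hBS : BaseStable) (hA : WORAllAbs n) (p : ℕ) (hp : p.Prime) (k : Type) [Field k] [CharP k p]
    (Y : Scheme.{0}) (g : Y ⟶ Spec (.of k)) (hB : IsBase Y g) (M : MarkedIdeal Y) (hM : IsDatum n M)
    (hall : ∀ y ∈ wildSet M n, P M.ideal y) : ∃ t : CentreSeq Y, WeakResolution t M := by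
  obtain ⟨t, hadm, hB', hM', hempty⟩ := wildElimination_of_nearPointFree hP hU hBS hB hM hall
  have hno : ¬ TopNoAbsContact t.top (t.transformMarked M).ideal n := by
    rw [topNoAbsContact_iff_wildSet_nonempty, hempty]
    exact Set.not_nonempty_empty
  obtain ⟨t', ht'⟩ := hA p hp k t.top (t.comp ≫ g) hB' (t.transformMarked M) hM' hno
  exact ⟨seqAppend t t', weakResolution_seqAppend t t' M hadm ht'⟩

/-- **THE δ-DECIDED SIDE (kernel, ports discharged by the tree: `orderUSC_holds`, `baseStable_holds`, `worAllAbs_of_five'`).**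
An `n`-datum all of whose wild closed top points are SPLIT or LIGHT or δ-LIGHT has a weak resolution, given `SeqDimFour 5 n`
(= `E 5` at `n`).  This is the closing law g23's decided cell needs; its residual complement is «some wild closed top point is
neither split nor light nor δ-light». [new] [folklore] -/
theorem wor_of_splitOrLightOrDeltaLight {n : ℕ} (hn : 1 ≤ n) (h5 : SeqDimFour 5 n) (p : ℕ) (hp : p.Prime) (k : Type)
    [Field k] [CharP k p] (Y : Scheme.{0}) (g : Y ⟶ Spec (.of k)) (hB : IsBase Y g) (M : MarkedIdeal Y) (hM : IsDatum n M)
    (hall : ∀ y ∈ wildSet M n, (DiffSplitAt M.ideal n y ∨ LightAt M.ideal n y) ∨ DeltaLightAt M.ideal n y) :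
    ∃ t : CentreSeq Y, WeakResolution t M :=
  wor_of_nearPointFree (nearPointFree_splitOrLightOrDeltaLight hn) orderUSC_holds baseStable_holds (worAllAbs_of_five' hn h5)
    p hp k Y g hB M hM hall

end Closing

end Summit.ResolutionOfSingularities.ResolutionOfSingularities.Theorems.DeltaCutClasses
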